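import Literature.AlgebraicGeometry.Resolution.Prop81MiddleAssemblyWithinDvd
import Literature.AlgebraicGeometry.Resolution.Prop81HeadExtractionF
import HarnessLib

/-!
# [CoP1] Prop. 8.1, second half, any rank and rational rank, exporting the final form of `F`

Topic: `Literature/AlgebraicGeometry/Resolution` (proofs only; no new notions, no new named
facts). `head_conclusion_of_principalized_within'` (`Prop81MiddleAssemblyWithinDvd.lean`) runs
the loops `E = F`, `♯E ≤ r` of [CoP1] Prop. 8.1 (V. Cossart, O. Piltant, HAL hal-00139124,
pp. 22–23) along a valuation of any rank and any rational rank and extracts the head of Prop. 9.3;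
its clause (c′) exports SOME tracked monomial `f₁`. For Cossart–Piltant 2019's descent
(J. Algebra 529 (2019) = arXiv:1412.0868, proof of Prop. 4.8, (510)–(512)) the final monomial
form of the tracked element `F` ITSELF is needed (the denominators of the model `𝒪_{Ŷ,ŷ}` divide
a power of `F`, so they become units times monomials: the shape elements of (512)). This file is
the same assembly with the extraction `head_conclusion_of_finalState_F`:

* `head_conclusion_of_principalized_within_F` — `head_conclusion_of_principalized_within'` with
  clause (c′) reading `F = w′ ∏_{i<r′} x′ᵢ^{eᵢ}`, `Fⁿ t″ ⊆ A`; proof verbatim.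

## Sources

* V. Cossart, O. Piltant, J. Algebra 320 (2008) 1051–1082: proof of Prop. 8.1 and of Prop. 9.3
  up to (47) (HAL hal-00139124, pp. 22–23, 27). [CossartPiltant2008]
* V. Cossart, O. Piltant, J. Algebra 529 (2019) 268–535 = arXiv:1412.0868, proof of Prop. 4.8
  with Lemma 4.7 and (510)–(512) (arXiv v1: Prop. 4.6, p. 53). [CossartPiltant2019]
-/

noncomputable section

namespace Literature.AlgebraicGeometry.Resolution

universe u

open IsLocalRing _root_.Polynomial Function

section MiddleWithinF

variable {S : Type u} [CommRing S] [IsDomain S] [IsLocalRing S] {E : Type u} [Field E]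
  [Algebra S E] [Algebra.IsAlgebraic S E]
  (hSuc : IsUniversallyCatenaryRing S) (hinj : Function.Injective (algebraMap S E))
  (OE : ValuationSubring E) (hSO : ∀ s : S, algebraMap S E s ∈ OE)
  (hdom : ∀ s ∈ maximalIdeal S, OE.valuation (algebraMap S E s) < 1)
  (hres : ∀ y : OE, ∃ q : S[X], (∃ i, q.coeff i ∉ maximalIdeal S) ∧
    OE.valuation (q.eval₂ (algebraMap S E) y) < 1)
  (hSdim : ringKrullDim S = (3 : ℕ))

set_option maxHeartbeats 1600000 in
include hSuc hinj hSO hdom hres hSdim in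
/-- **[CoP1] Prop. 8.1, second half, and the head extraction, for a valuation of any rank and
any rational rank, exporting the final monomial form of `F`**: as
`head_conclusion_of_principalized_within'`, with clause (c′) stated for the tracked element `F`:
in the final regular parameters `F = w′ ∏_{i<r′} x′ᵢ^{eᵢ}` with `w′` a unit, and `Fⁿ t″ ⊆ A`.
[cite: CossartPiltant2008, proof of Prop. 8.1 (HAL pp. 22–23) and of Prop. 9.3 (p. 27)]
[cite: CossartPiltant2019, proof of Prop. 4.8 with Lemma 4.7 and (510)–(512) (arXiv v1: Prop. 4.6, p. 53)] -/
theorem head_conclusion_of_principalized_within_F (A : Subring E)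
    (hSA : ∀ s : S, algebraMap S E s ∈ A)
    (M K' : Subfield E) (hSK : ∀ s : S, algebraMap S E s ∈ K') (B₀ : Subalgebra S E)
    (t : Set E) (ht : t.Finite) (htK : t ⊆ K')
    (hTO : (Algebra.adjoin S t).toSubring ≤ OE.toSubring) (hB₀ : B₀ ≤ Algebra.adjoin S t)
    (hreg : IsRegularLocalRing (locAtCentre (Algebra.adjoin S t).toSubring OE))
    (x : Fin 3 → locAtCentre (Algebra.adjoin S t).toSubring OE)
    (hx : haveI := isLocalRing_locAtCentre hTO
      Ideal.span (Set.range x) = maximalIdeal _)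
    (F u : E) (hFA : F ∈ A) (huR : u ∈ locAtCentre (Algebra.adjoin S t).toSubring OE)
    (hvu : OE.valuation u = 1) (α : Fin 3 → ℕ) (hF : F = u * ∏ c, (x c : E) ^ α c)
    (hTR : ∀ z ∈ t, ∃ n : ℕ, F ^ n * z ∈ A)
    (C : Subring E) (hAC : A ≤ C) (hFC : F⁻¹ ∈ C)
    (harchC : ∀ y ∈ locAtCentre C OE, OE.valuation y < 1 →
      ∃ n : ℕ, OE.valuation y ^ n ≤ OE.valuation F)
    (h w : E) (hwR : w ∈ locAtCentre (Algebra.adjoin S t).toSubring OE)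
    (hvw : OE.valuation w = 1) (β : Fin 3 → ℕ) (hh : h = w * ∏ c, (x c : E) ^ β c)
    (hβα : ∀ c, 0 < β c → 0 < α c) (hβne : ∃ c, 0 < β c)
    (hdomA : ∀ y ∈ A, OE.valuation y < 1 →
      ∃ c ∈ locAtCentre (Algebra.adjoin S t).toSubring OE, y = h * c)
    (r : ℕ) (hr0 : 0 < r)
    (hdep : ∀ (I : Finset (Fin 3)) (y : Fin 3 → E), r < I.card → (∀ k, y k ≠ 0) →
      (∀ k ∈ I, y k ∈ locAtCentre C OE ∧ OE.valuation F ≤ OE.valuation (y k)) →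
      ∃ c : Fin 3 → ℤ, (∀ k, k ∉ I → c k = 0) ∧ c ≠ 0 ∧
        ∏ k, OE.valuation (y k) ^ (c k).toNat = ∏ k, OE.valuation (y k) ^ (-c k).toNat)
    (f : Fin r → E) (hfM : ∀ i, f i ∈ M)
    (hfR : ∀ i, f i ∈ locAtCentre (Algebra.adjoin S t).toSubring OE)
    (hfdvd : ∀ i, ∃ c ∈ locAtCentre (Algebra.adjoin S t).toSubring OE, F = f i * c)
    (hind : ∀ p m : Fin r → ℕ, ∏ i, OE.valuation (f i) ^ p i = ∏ i, OE.valuation (f i) ^ m i →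
      p = m) :
    ∃ (t'' : Finset E) (_ : (t'' : Set E) ⊆ K')
      (hTO' : (Algebra.adjoin S (t'' : Set E)).toSubring ≤ OE.toSubring)
      (_ : B₀ ≤ Algebra.adjoin S (t'' : Set E))
      (_ : IsRegularLocalRing (locAtCentre (Algebra.adjoin S (t'' : Set E)).toSubring OE))
      (r' : ℕ) (hr' : r' ≤ 3) (_ : 0 < r')
      (x' : Fin 3 → locAtCentre (Algebra.adjoin S (t'' : Set E)).toSubring OE),
      (∀ j, ((x' j : locAtCentre (Algebra.adjoin S (t'' : Set E)).toSubring OE) : E) ≠ 0) ∧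
      (haveI := isLocalRing_locAtCentre hTO'
       Ideal.span (Set.range x') =
         maximalIdeal (locAtCentre (Algebra.adjoin S (t'' : Set E)).toSubring OE)) ∧
      (∀ y : locAtCentre (Algebra.adjoin S (t'' : Set E)).toSubring OE,
        (y : E) ∈ A → OE.valuation (y : E) < 1 →
        y ∈ Ideal.span {∏ i : Fin r', x' (Fin.castLE hr' i)}) ∧
      (∃ (f' : Fin r' → E)
          (γ' : Fin r' → (locAtCentre (Algebra.adjoin S (t'' : Set E)).toSubring OE)ˣ)
          (a' : Matrix (Fin r') (Fin r') ℕ),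
        (∀ i, f' i ∈ M) ∧
        (∀ i, f' i = ((γ' i : locAtCentre (Algebra.adjoin S (t'' : Set E)).toSubring OE) : E) *
          ∏ j, ((x' (Fin.castLE hr' j) :
            locAtCentre (Algebra.adjoin S (t'' : Set E)).toSubring OE) : E) ^ a' i j) ∧
        (a'.map (fun n : ℕ => (n : ℤ))).det ≠ 0) ∧
      (∃ (w' : (locAtCentre (Algebra.adjoin S (t'' : Set E)).toSubring OE)ˣ)
          (e : Fin r' → ℕ),
        F = ((w' : locAtCentre (Algebra.adjoin S (t'' : Set E)).toSubring OE) : E) *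
          ∏ i, ((x' (Fin.castLE hr' i) :
            locAtCentre (Algebra.adjoin S (t'' : Set E)).toSubring OE) : E) ^ e i) ∧
      (∀ z ∈ (t'' : Set E), ∃ n : ℕ, F ^ n * z ∈ A) := by
  classical
  -- the loop `E = F`
  obtain ⟨t₁, htt₁, ht₁, ht₁K, hTR₁, hT₁O, hreg₁, hsub₁, x₁, u₁, w₁, α₁, β₁, hspan₁, hu₁R, hvu₁,
    hw₁R, hvw₁, hF₁, hh₁, hEF₁⟩ :=
    exists_frameStepsTracked_supp_eq_subset_within' hSuc hinj OE hSO hdom hres hSdim A hSA F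
      hFA K' hSK C hAC hFC harchC t ht htK hTR hTO hreg x hx h u w huR hvu hwR hvw α β hF hh hβα
      hβne
  -- the loop `♯E ≤ r`, the relations being asked only for parameters dividing `F` in `C`
  have hcard₁ : (Finset.univ.filter (fun c => 0 < α₁ c)).card ≤ r + 3 := by
    have := Finset.card_le_univ (Finset.univ.filter (fun c => 0 < α₁ c))
    rw [Fintype.card_fin] at this
    omega
  obtain ⟨t₂, ht₁t₂, ht₂, ht₂K, hTR₂, hT₂O, hreg₂, hsub₂, x₂, u₂, w₂, α₂, β₂, hspan₂, hu₂R, hvu₂,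
    hw₂R, hvw₂, hF₂, hh₂, hEF₂, hcard₂⟩ :=
    exists_frameStepsTracked_card_supp_le_subset_within hSuc hinj OE hSO hdom hres hSdim A hSA F
      hFA K' hSK C hAC hFC r hdep 3 t₁ ht₁ ht₁K hTR₁ hT₁O hreg₁ x₁ hspan₁ h u₁ w₁ hu₁R hvu₁ hw₁R
      hvw₁ α₁ β₁ hF₁ hh₁ hEF₁ hcard₁
  haveI := isLocalRing_locAtCentre hT₂O
  set E' : Finset (Fin 3) := Finset.univ.filter (fun c => 0 < α₂ c) with hE'def
  have hx₂0 : ∀ j, (x₂ j : E) ≠ 0 := fun j =>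
    coe_rsop_ne_zero_of_frame hSuc hinj OE hSO hdom hres hSdim t₂ ht₂ hT₂O hreg₂ x₂ hspan₂ j
  -- the `fᵢ` are monomials supported in `E′` in the final parameters
  have hu₂inv : u₂⁻¹ ∈ locAtCentre (Algebra.adjoin S t₂).toSubring OE := inv_mem_locAtCentre hu₂R hvu₂
  have hfmono : ∀ i, ∃ (γ : E) (a : Fin 3 → ℕ),
      γ ∈ locAtCentre (Algebra.adjoin S t₂).toSubring OE ∧ OE.valuation γ = 1 ∧
      (∀ c, c ∉ E' → a c = 0) ∧ f i = γ * ∏ c, (x₂ c : E) ^ a c := by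
    intro i
    obtain ⟨cᵢ, hcᵢ, hFc⟩ := hfdvd i
    have hfR₂ : f i ∈ locAtCentre (Algebra.adjoin S t₂).toSubring OE := hsub₂ (hsub₁ (hfR i))
    have hcR₂ : cᵢ ∈ locAtCentre (Algebra.adjoin S t₂).toSubring OE := hsub₂ (hsub₁ hcᵢ)
    -- `f i ∣ u₂ ∏ x₂^{α₂}` in the local ring
    have hdvd : (⟨f i, hfR₂⟩ : locAtCentre (Algebra.adjoin S t₂).toSubring OE) ∣
        ∏ c, x₂ c ^ α₂ c := by
      refine ⟨⟨cᵢ, hcR₂⟩ * ⟨u₂⁻¹, hu₂inv⟩, Subtype.ext ?_⟩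
      simp only [Subring.coe_mul, SubmonoidClass.coe_finsetProd, SubmonoidClass.coe_pow]
      have hu₂0 : u₂ ≠ 0 := ne_zero_of_valuation_eq_one hvu₂
      rw [show (∏ c, (x₂ c : E) ^ α₂ c) = u₂⁻¹ * F by rw [hF₂]; field_simp, hFc]
      ring
    haveI := hreg₂
    have hdimR : ringKrullDim (locAtCentre (Algebra.adjoin S t₂).toSubring OE) = (3 : ℕ) := by
      haveI : Algebra.FiniteType S (Algebra.adjoin S t₂) := by
        rw [← ht₂.coe_toFinset]
        exact (Subalgebra.fg_iff_finiteType _).mp (Subalgebra.fg_adjoin_finset _)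
      rw [ringKrullDim_locAtCentre_eq_of_frame hSuc hinj OE hSO hdom hres (Algebra.adjoin S t₂)
        hT₂O, hSdim]
    have hd : (maximalIdeal (locAtCentre (Algebra.adjoin S t₂).toSubring OE)).spanFinrank = 3 := by
      have h := IsRegularLocalRing.spanFinrank_maximalIdeal
        (R := locAtCentre (Algebra.adjoin S t₂).toSubring OE)
      rw [hdimR] at h
      exact_mod_cast h
    have hprime : ∀ c, Prime (x₂ c) := by
      intro c
      have h := isPrime_span_image hd x₂ hspan₂ {c}
      rw [Finset.coe_singleton, Set.image_singleton] at h
      refine (Ideal.span_singleton_prime ?_).mp h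
      intro h0
      exact hx₂0 c (by rw [h0]; rfl)
    haveI : IsDomain (locAtCentre (Algebra.adjoin S t₂).toSubring OE) := inferInstance
    obtain ⟨γu, a, hγa⟩ :=
      CossartPiltantMonomial.exists_eq_units_mul_prod_pow_of_dvd hprime α₂ hdvd
    have hγval : OE.valuation ((γu : locAtCentre (Algebra.adjoin S t₂).toSubring OE) : E) = 1 := by
      have hle : OE.valuation ((γu : locAtCentre (Algebra.adjoin S t₂).toSubring OE) : E) ≤ 1 :=
        (OE.valuation_le_one_iff _).mpr (locAtCentre_le hT₂O γu.val.2)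
      have hnlt : ¬ OE.valuation ((γu : locAtCentre (Algebra.adjoin S t₂).toSubring OE) : E) < 1 :=
        fun hlt => ((not_isUnit_locAtCentre_iff hT₂O _).mpr hlt) γu.isUnit
      exact le_antisymm hle (not_lt.mp hnlt)
    refine ⟨(γu : locAtCentre (Algebra.adjoin S t₂).toSubring OE), a, γu.val.2,
      hγval, fun c hc => ?_, ?_⟩
    · -- support: `x₂ c ∣ f i ∣ F = u₂ x₂^{α₂}` forces `α₂ c > 0`
      by_contra ha0
      have hac : 0 < a c := Nat.pos_of_ne_zero ha0
      have hxdvdf : x₂ c ∣ (⟨f i, hfR₂⟩ : locAtCentre (Algebra.adjoin S t₂).toSubring OE) := by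
        rw [hγa]
        refine Dvd.dvd.mul_left ?_ _
        exact (dvd_pow_self (x₂ c) hac.ne').trans (Finset.dvd_prod_of_mem _ (Finset.mem_univ c))
      have hxdvdF : x₂ c ∣ ⟨u₂, hu₂R⟩ * ∏ k, x₂ k ^ α₂ k := by
        have hFR₂ : (⟨f i, hfR₂⟩ : locAtCentre (Algebra.adjoin S t₂).toSubring OE) ∣
            ⟨u₂, hu₂R⟩ * ∏ k, x₂ k ^ α₂ k := by
          refine ⟨⟨cᵢ, hcR₂⟩, Subtype.ext ?_⟩
          simp only [Subring.coe_mul, SubmonoidClass.coe_finsetProd, SubmonoidClass.coe_pow]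
          rw [← hF₂, hFc]
        exact hxdvdf.trans hFR₂
      have hpos := pos_of_rsop_dvd_monomial hSuc hinj OE hSO hdom hres hSdim t₂ ht₂ hT₂O hreg₂ x₂
        hspan₂ ⟨u₂, hu₂R⟩ hvu₂ α₂ c hxdvdF
      exact hc (Finset.mem_filter.mpr ⟨Finset.mem_univ _, hpos⟩)
    · have := congrArg Subtype.val hγa
      simpa only [Subring.coe_mul, SubmonoidClass.coe_finsetProd, SubmonoidClass.coe_pow] using this
  choose γ a hγR hvγ hsuppa hfa using hfmono
  -- extraction
  exact head_conclusion_of_finalState_F OE M K' A B₀ t₂ ht₂ ht₂K hT₂O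
    (hB₀.trans (Algebra.adjoin_mono (htt₁.trans ht₁t₂))) hreg₂ x₂ hx₂0 hspan₂ E' r hr0 hcard₂ F u₂
    hu₂R hvu₂ α₂ (fun c hc => Nat.eq_zero_of_not_pos fun hp =>
      hc (Finset.mem_filter.mpr ⟨Finset.mem_univ _, hp⟩)) hF₂ hTR₂ h w₂ hw₂R β₂
    (fun c hc => (hEF₂ c).mp (Finset.mem_filter.mp hc).2) hh₂
    (fun y hy hvy => by
      obtain ⟨c, hc, hyc⟩ := hdomA y hy hvy
      exact ⟨c, hsub₂ (hsub₁ hc), hyc⟩)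
    f γ hfM hγR hvγ a hsuppa hfa hind

end MiddleWithinF

end Literature.AlgebraicGeometry.Resolution

end
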